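/-
Copyright (c) 2026 the pub-hodgecm-mathlib formalisation cell (harness21).  Prover seat hodgecm-mathlib-R90-C14-p01 (g0), HCML SLAB R90-TF,
section S3 «§12.7 endoscopic character identities» (base `R90-C12`), deal S3-p12 «(VD₂) vector-valued van Dijk» (R90-C12-plan (g0),
R90 bus 2026-09-04T22:11:59Z), brick B1.  2026-09-04.
-/
import Mathlib.LinearAlgebra.Trace
import Mathlib.LinearAlgebra.Pi
import HarnessLib

/-!
# R90 · S3 — (VD₂) brick B1: the trace of a BLOCK-KERNEL operator on `Y → W` is the sum of the traces of its diagonal blocks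
# (`Theorems/R90S3BlockKernelOperatorTrace.lean`; the vector-valued twin of ★ VD-1 `Literature.LinearAlgebra.trace_kernelOp_eq_sum_diag`)

Cell `hodgecm-mathlib`, crux H413 (`stmt-HodgeConjecture-24833`), route of record `HCCMUnconditional`; programme R90-TF, section S3 (base `R90-C12`),
seat R90-C14-p01 (g0); deal S3-p12 «(VD₂) vector-valued van Dijk for the `(2,1)` parabolic of `GL₃`» (R90-C12-plan (g0) 22:11:59Z; R0 22:15:26Z).
Helper lane `--supports stmt-HodgeConjecture-24833 --as helper`; THEOREMS ONLY (no definition, no instance, no notation, no named fact, no `sorry`);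
imports = Mathlib + HarnessLib.

THE ROAD (R0, brick B1 of B1–B5).  van Dijk's formula `tr Ind_P^G(σ)(f) = tr σ(f̄^P)` [vanDijk1972, Thm. p. 237; BernsteinZelevinsky1977 §2.3;
Rogawski1990 §4.13 Lemma 4.13.1 (b) p. 64] for a VECTOR-VALUED (admissible) inducing datum `σ` on `W` realises `π(f)|_{V^{K′}}` as the restriction to
the model `V^{K′} ↪ (K⧸K′ → W₀)` (`W₀ = W^{H∩K′}` finite-dimensional) of a BLOCK-KERNEL operator
`(𝒜ψ)(y) = Σ_{y′} A(y,y′)(ψ(y′))`, `A : Y → Y → End(W₀)` (`Y = K⧸K′` finite), whose trace is the sum of the traces of the diagonal blocks.  This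
brick is that piece of linear algebra, the `End(W₀)`-valued twin of ★ `Literature.LinearAlgebra.trace_kernelOp_eq_sum_diag` (scalar kernels).  The
operator is written WITHOUT a definition, as the closed Mathlib term `Σ_y Σ_{y′} single y ∘ A y y′ ∘ proj y′`.
* `blockKernelOp_apply` — `(Σ_y Σ_{y′} single y ∘ A y y′ ∘ proj y′) ψ y₀ = Σ_{y′} A y₀ y′ (ψ y′)`;
* **`trace_blockKernelOp_eq_sum_trace_diag`** — `tr (Σ_y Σ_{y′} single y ∘ A y y′ ∘ proj y′) = Σ_y tr (A y y)` (`tr (single y ∘ B ∘ proj y′) =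
  tr (proj y′ ∘ single y ∘ B)` by `LinearMap.trace_comp_comm'`, and `proj y′ ∘ single y = δ_{y y′}`);
* `trace_restrict_blockKernelOp_eq_sum_trace_diag` — the same for the restriction to any subspace `S` containing the range (`tr (T|_S) = tr T` when
  `range T ≤ S`, via `LinearMap.trace_comp_comm'` for `T = ι_S ∘ T♯`, `T|_S = T♯ ∘ ι_S`); `trace_eq_sum_trace_diag_of_eq_blockKernelOp` — the same for ANY
  endomorphism of `S` whose values are computed by the block kernel (twin of ★ `Literature.LinearAlgebra.trace_eq_sum_diag_of_eq_kernelOp`).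
HONEST LABEL: linear algebra; pays no socket by itself.  HC_CM is proved only modulo the 7 printed citations (2 remaining named inputs: hLiu418 =
stmt-HodgeConjecture-24832, h413 = stmt-HodgeConjecture-24833) until rung 0 closes; count-neutral helper.

## References
* [vanDijk1972] G. van Dijk, *Computation of certain induced characters of 𝔭-adic groups*, Math. Ann. 199 (1972), 229–240, Thm. p. 237.
* [BernsteinZelevinsky1977] I. N. Bernstein, A. V. Zelevinsky, *Induced representations of reductive 𝔭-adic groups I*, Ann. Sci. ÉNS 10 (1977), §2.3.
* [Bump1997] D. Bump, *Automorphic Forms and Representations* (1997), §4.4 pp. 458–459 (trace of an integral operator = integral of the kernel on the diagonal).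
-/

set_option autoImplicit false
-- the mandated namespace repeats the single-problem summit's segment (`HodgeConjecture.HodgeConjecture`)
set_option linter.dupNamespace false

noncomputable section

open scoped BigOperators

namespace Summit.HodgeConjecture.HodgeConjecture.R90.S3

variable {k : Type*} [Field k] {Y : Type*} [Fintype Y] [DecidableEq Y] {W : Type*} [AddCommGroup W] [Module k W]

/-- **The block-kernel operator, applied**: `(Σ_y Σ_{y′} single y ∘ A y y′ ∘ proj y′) ψ y₀ = Σ_{y′} A y₀ y′ (ψ y′)`. [cite: Bump1997, §4.4 pp. 458–459] -/
theorem blockKernelOp_apply (A : Y → Y → Module.End k W) (ψ : Y → W) (y₀ : Y) :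
    (∑ y : Y, ∑ y' : Y, LinearMap.single k (fun _ : Y => W) y ∘ₗ A y y' ∘ₗ LinearMap.proj y') ψ y₀ = ∑ y' : Y, A y₀ y' (ψ y') := by
  rw [LinearMap.sum_apply, Finset.sum_apply, Finset.sum_eq_single y₀]
  · rw [LinearMap.sum_apply, Finset.sum_apply]
    refine Finset.sum_congr rfl fun y' _ => ?_
    rw [LinearMap.comp_apply, LinearMap.comp_apply, LinearMap.proj_apply, LinearMap.coe_single, Pi.single_eq_same]
  · intro y _ hy
    rw [LinearMap.sum_apply, Finset.sum_apply]
    refine Finset.sum_eq_zero fun y' _ => ?_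
    rw [LinearMap.comp_apply, LinearMap.comp_apply, LinearMap.coe_single, Pi.single_eq_of_ne (Ne.symm hy)]
  · intro h; exact absurd (Finset.mem_univ y₀) h

variable [FiniteDimensional k W]

/-- **THE TRACE OF A BLOCK-KERNEL OPERATOR IS THE SUM OF THE TRACES OF ITS DIAGONAL BLOCKS**: for `Y` finite, `W` finite-dimensional and
`A : Y → Y → End(W)`, `tr (Σ_y Σ_{y′} single y ∘ A y y′ ∘ proj y′) = Σ_y tr (A y y)` — the `End(W)`-valued twin of ★ VD-1
`Literature.LinearAlgebra.trace_kernelOp_eq_sum_diag`. [cite: vanDijk1972, Thm. p. 237] [cite: Bump1997, §4.4 pp. 458–459] -/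
theorem trace_blockKernelOp_eq_sum_trace_diag (A : Y → Y → Module.End k W) :
    LinearMap.trace k (Y → W) (∑ y : Y, ∑ y' : Y, LinearMap.single k (fun _ : Y => W) y ∘ₗ A y y' ∘ₗ LinearMap.proj y') =
      ∑ y : Y, LinearMap.trace k W (A y y) := by
  rw [map_sum]
  refine Finset.sum_congr rfl fun y _ => ?_
  rw [map_sum, Finset.sum_eq_single y]
  · -- `tr (single y ∘ A y y ∘ proj y) = tr (proj y ∘ single y ∘ A y y) = tr (A y y)`
    rw [LinearMap.trace_comp_comm', LinearMap.comp_assoc, LinearMap.proj_comp_single_same, LinearMap.comp_id]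
  · intro y' _ hy'
    rw [LinearMap.trace_comp_comm', LinearMap.comp_assoc, LinearMap.proj_comp_single_ne k (fun _ : Y => W) y' y hy', LinearMap.comp_zero, map_zero]
  · intro h; exact absurd (Finset.mem_univ y) h

/-- **Restriction to an invariant subspace containing the range**: if the block-kernel operator maps `Y → W` into a subspace `S` then the trace of its
restriction to `S` is again `Σ_y tr (A y y)` (`tr (T|_S) = tr T` when `range T ≤ S`: conjugate-free, via `LinearMap.trace_comp_comm'` for
`T = ι_S ∘ T♯`, `T|_S = T♯ ∘ ι_S`).  This is the form the induced model consumes (`V^{K′} ≅ S ⊆ (K⧸K′ → W₀)`, `π(f)|_{V^{K′}} = 𝒜|_S`).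
[cite: vanDijk1972, Thm. p. 237] [cite: BernsteinZelevinsky1977, §2.3] -/
theorem trace_restrict_blockKernelOp_eq_sum_trace_diag (A : Y → Y → Module.End k W) (S : Submodule k (Y → W))
    (hS : ∀ ψ, (∑ y : Y, ∑ y' : Y, LinearMap.single k (fun _ : Y => W) y ∘ₗ A y y' ∘ₗ LinearMap.proj y') ψ ∈ S) :
    LinearMap.trace k S ((∑ y : Y, ∑ y' : Y, LinearMap.single k (fun _ : Y => W) y ∘ₗ A y y' ∘ₗ LinearMap.proj y').restrict
        (fun x (_ : x ∈ S) => hS x)) =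
      ∑ y : Y, LinearMap.trace k W (A y y) := by
  set T : (Y → W) →ₗ[k] (Y → W) := ∑ y : Y, ∑ y' : Y, LinearMap.single k (fun _ : Y => W) y ∘ₗ A y y' ∘ₗ LinearMap.proj y' with hT
  -- `T = ι ∘ T♯`, `T|_S = T♯ ∘ ι`
  set Tc : (Y → W) →ₗ[k] S := LinearMap.codRestrict S T hS with hTc
  have h1 : T.restrict (fun x (_ : x ∈ S) => hS x) = Tc ∘ₗ S.subtype := by
    ext x
    rfl
  have h2 : S.subtype ∘ₗ Tc = T := by
    ext x
    rfl
  rw [h1, LinearMap.trace_comp_comm', h2, hT, trace_blockKernelOp_eq_sum_trace_diag]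

/-- **Any endomorphism `T` of `S` computed by the block kernel** (the way ★ `Representation.levelActOp` is given: an endomorphism of the fixed vectors whose values
are computed by the ambient formula) has trace `Σ_y tr (A y y)` — the `End(W)`-valued twin of ★ `Literature.LinearAlgebra.trace_eq_sum_diag_of_eq_kernelOp`.
[cite: vanDijk1972, Thm. p. 237] [cite: BernsteinZelevinsky1977, §2.3] -/
theorem trace_eq_sum_trace_diag_of_eq_blockKernelOp (A : Y → Y → Module.End k W) (S : Submodule k (Y → W))
    (hS : ∀ ψ, (∑ y : Y, ∑ y' : Y, LinearMap.single k (fun _ : Y => W) y ∘ₗ A y y' ∘ₗ LinearMap.proj y') ψ ∈ S) (T : S →ₗ[k] S)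
    (hT : ∀ w : S, ((T w : S) : Y → W) = (∑ y : Y, ∑ y' : Y, LinearMap.single k (fun _ : Y => W) y ∘ₗ A y y' ∘ₗ LinearMap.proj y') (w : Y → W)) :
    LinearMap.trace k S T = ∑ y : Y, LinearMap.trace k W (A y y) := by
  rw [← trace_restrict_blockKernelOp_eq_sum_trace_diag A S hS]
  congr 1
  refine LinearMap.ext fun w => Subtype.ext ?_
  rw [hT w, LinearMap.coe_restrict_apply]

end Summit.HodgeConjecture.HodgeConjecture.R90.S3

end
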